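import Literature.Analysis.Pluripotential.LelongNumberComparison
import HarnessLib

/-!
# Restriction of closed positive `(1,1)`-currents on `ℙᴺ(ℂ)` to projective linear subspaces

Topic `Literature/Analysis/Pluripotential`. An injective linear map
`ι : ℂ^{M+1} → ℂ^{N+1}` induces the linear embedding `ℙ(ι) : ℙᴹ ↪ ℙᴺ`, and a closed positive
`(1,1)`-current `T` on `ℙᴺ` with cone potential `V` RESTRICTS to the subspace as the current with
cone potential `V ∘ ι` — provided `V ∘ ι ≢ -∞` near every point, i.e. the subspace is not
(locally) contained in the polar set of `T` (`ClosedPositiveOneOneCurrent.restrictLinear`, a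
DEFINITION with body: the psh property pulls back along affine maps,
`IsPlurisubharmonicOn.comp_clm_add`; log-homogeneity and the degree are inherited). Main results:

* `ClosedPositiveOneOneCurrent.lelongNumber_map_le_lelongNumber_restrictLinear` — **restriction
  can only increase Lelong numbers**: `ν(T, ℙ(ι) x) ≤ ν(T|, x)` (pull-back of admissible slopes,
  `lelongSlopes_subset_lelongSlopes_comp`, with the boundedness of slopes of psh functions
  `IsPlurisubharmonicOn.bddAbove_lelongSlopes_of_ne_bot`);
* `ClosedPositiveOneOneCurrent.lelongUpperLevelSet_inter_range_subset` — hence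
  `E_c(T) ∩ ℙ(ι)(ℙᴹ) ⊆ ℙ(ι)(E_c(T|))`: upper level sets are controlled by those of the slices
  (the set-up of Siu's slicing arguments).

## References

* [Siu1974] Y.-T. Siu, Analyticity of sets associated to Lelong numbers and the extension of
  closed positive currents, Invent. Math. 27 (1974), §§1–2 (slicing, restriction to subspaces).
* [HormanderSCV1973] L. Hörmander, An introduction to complex analysis in several variables
  (1973), §2.6 (psh functions pull back under holomorphic, in particular affine, maps).
-/

noncomputable section

open scoped Topology ENNReal Manifold ContDiff LinearAlgebra.Projectivization
open Filter Set Metric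

namespace Literature.Analysis.Pluripotential

/-! ### Plurisubharmonic functions pull back along affine maps -/

/-- **Pull-back of psh functions along continuous affine maps**: if `u` is plurisubharmonic on
`Ω ⊆ E` and `φ(z) = A z + b` with `A : E' →L[ℂ] E`, then `u ∘ φ` is plurisubharmonic on `φ⁻¹(Ω)`.
[cite: HormanderSCV1973, §2.6; folklore] -/
theorem IsPlurisubharmonicOn.comp_clm_add {E E' : Type*} [NormedAddCommGroup E] [NormedSpace ℂ E]
    [NormedAddCommGroup E'] [NormedSpace ℂ E'] {u : E → EReal} {Ω : Set E}
    (hu : IsPlurisubharmonicOn u Ω) (A : E' →L[ℂ] E) (b : E) :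
    IsPlurisubharmonicOn (fun z ↦ u (A z + b)) ((fun z ↦ A z + b) ⁻¹' Ω) := by
  set φ : E' → E := fun z ↦ A z + b with hφ
  have hφc : Continuous φ := A.continuous.add continuous_const
  refine ⟨fun x hx y hy ↦ ?_, fun z hz ↦ hu.lt_top hz, fun z w ↦ ?_⟩
  · have h := hu.upperSemicontinuousOn (φ x) hx y hy
    exact (hφc.continuousWithinAt.tendsto_nhdsWithin (mapsTo_preimage φ Ω)).eventually h
  · have hline : ∀ τ : ℂ, φ (z + τ • w) = φ z + τ • A w := fun τ ↦ by
      simp only [hφ, map_add, map_smul]; abel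
    have hfun : (fun τ : ℂ ↦ u (A (z + τ • w) + b)) = fun τ ↦ u (φ z + τ • A w) :=
      funext fun τ ↦ congrArg u (hline τ)
    have hset : {τ : ℂ | z + τ • w ∈ φ ⁻¹' Ω} = {τ | φ z + τ • A w ∈ Ω} := by
      ext τ; rw [mem_setOf_eq, mem_preimage, hline]; rfl
    rw [hfun, hset]
    exact hu.isSubharmonicOn_line (φ z) (A w)

/-- Boundedness of the admissible slopes of a psh function which is `≢ -∞` near the point (the
standard consequence of the three-balls inequality, packaged). [folklore] -/
theorem IsPlurisubharmonicOn.bddAbove_lelongSlopes_of_ne_bot {E : Type*} [NormedAddCommGroup E]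
    [NormedSpace ℂ E] [Nontrivial E] [ProperSpace E] {V : E → EReal} {Ω : Set E}
    (hV : IsPlurisubharmonicOn V Ω) {a : E} {r₀ : ℝ} (hr₀ : 0 < r₀) (hΩ : closedBall a r₀ ⊆ Ω)
    (hnb : ∀ ρ : ℝ, 0 < ρ → ∃ z ∈ closedBall a ρ, V z ≠ ⊥) : BddAbove (lelongSlopes V a) := by
  have hfin : ∀ {ρ : ℝ}, 0 < ρ → ρ ≤ r₀ →
      sSup (V '' closedBall a ρ) ≠ ⊥ ∧ sSup (V '' closedBall a ρ) ≠ ⊤ := fun hρ hρr ↦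
    ⟨sSup_image_closedBall_ne_bot (hnb _ hρ),
      (sSup_image_closedBall_lt_top hV.upperSemicontinuousOn (fun z hz ↦ hV.lt_top hz)
        ((closedBall_subset_closedBall hρr).trans hΩ)).ne⟩
  set mr : ℝ := (sSup (V '' closedBall a r₀)).toReal with hmr_def
  have hmr_eq : (mr : EReal) = sSup (V '' closedBall a r₀) :=
    EReal.coe_toReal (hfin hr₀ le_rfl).2 (hfin hr₀ le_rfl).1
  have hmr : ∀ z ∈ closedBall a r₀, V z ≤ mr := fun z hz ↦ by
    rw [hmr_eq]; exact le_sSup ⟨z, hz, rfl⟩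
  have h2 := hfin (half_pos hr₀) (half_le_self hr₀.le)
  exact hV.bddAbove_lelongSlopes (half_pos hr₀) (half_lt_self hr₀) hΩ
    (EReal.coe_toReal h2.2 h2.1).le hmr

/-- A psh function is bounded above near every point of its (open) domain, punctured form.
[folklore] -/
theorem IsPlurisubharmonicOn.eventually_le_coe {E : Type*} [NormedAddCommGroup E]
    [NormedSpace ℂ E] [ProperSpace E] {V : E → EReal} {Ω : Set E} (hV : IsPlurisubharmonicOn V Ω)
    {a : E} {r : ℝ} (hr : 0 < r) (hΩ : closedBall a r ⊆ Ω) :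
    ∃ C : ℝ, ∀ᶠ z in 𝓝[≠] a, V z ≤ (C : EReal) := by
  have hlt := sSup_image_closedBall_lt_top hV.upperSemicontinuousOn (fun z hz ↦ hV.lt_top hz) hΩ
  obtain ⟨C, hC⟩ : ∃ C : ℝ, sSup (V '' closedBall a r) ≤ (C : EReal) := by
    rcases eq_or_ne (sSup (V '' closedBall a r)) ⊥ with hb | hb
    · exact ⟨0, hb ▸ bot_le⟩
    · exact ⟨_, (EReal.coe_toReal hlt.ne hb).ge⟩
  refine ⟨C, mem_nhdsWithin_of_mem_nhds ?_⟩
  filter_upwards [closedBall_mem_nhds a hr] with z hz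
  exact le_trans (le_sSup (mem_image_of_mem V hz)) hC

namespace ClosedPositiveOneOneCurrent

variable {M N : ℕ}

/-- **Restriction of a current to a projective linear subspace.** For an injective linear map
`ι : ℂ^{M+1} → ℂ^{N+1}` and a closed positive `(1,1)`-current `T` on `ℙᴺ` whose cone potential is
`≢ -∞` near every point of the subspace (hypothesis `hT`: the subspace is not locally contained in
the polar set), the current `T|_{ℙ(ι)}` on `ℙᴹ` with cone potential `V ∘ ι` and the same degree.
[cite: Siu1974, §2 (slicing); folklore] -/
def restrictLinear (T : ClosedPositiveOneOneCurrent N)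
    (ι : (Fin (M + 1) → ℂ) →ₗ[ℂ] (Fin (N + 1) → ℂ)) (hι : Function.Injective ι)
    (hT : ∀ v : Fin (M + 1) → ℂ, v ≠ 0 → ∃ᶠ y in 𝓝 v, T.pot (ι y) ≠ ⊥) :
    ClosedPositiveOneOneCurrent M where
  pot v := T.pot (ι v)
  degree := T.degree
  degree_nonneg := T.degree_nonneg
  isPlurisubharmonicOn_pot := by
    have h := T.isPlurisubharmonicOn_pot.comp_clm_add (LinearMap.toContinuousLinearMap ι) 0
    simp only [add_zero, LinearMap.coe_toContinuousLinearMap'] at h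
    refine h.mono fun v hv ↦ ?_
    rw [mem_preimage, mem_compl_singleton_iff]
    exact fun h0 ↦ hv (hι (by rw [h0, map_zero]))
  isLogHomogeneous_pot a v ha hv := by
    show T.pot (ι (a • v)) = T.pot (ι v) + _
    rw [map_smul]
    exact T.isLogHomogeneous_pot a (ι v) ha fun h0 ↦ hv (hι (by rw [h0, map_zero]))
  frequently_ne_bot := hT

/-- The cone potential of the restriction. [folklore] -/
@[simp] theorem restrictLinear_pot (T : ClosedPositiveOneOneCurrent N)
    (ι : (Fin (M + 1) → ℂ) →ₗ[ℂ] (Fin (N + 1) → ℂ)) (hι : Function.Injective ι)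
    (hT : ∀ v : Fin (M + 1) → ℂ, v ≠ 0 → ∃ᶠ y in 𝓝 v, T.pot (ι y) ≠ ⊥) (v : Fin (M + 1) → ℂ) :
    (T.restrictLinear ι hι hT).pot v = T.pot (ι v) := rfl

/-- The degree of the restriction is the degree of `T`. [folklore] -/
@[simp] theorem degree_restrictLinear (T : ClosedPositiveOneOneCurrent N)
    (ι : (Fin (M + 1) → ℂ) →ₗ[ℂ] (Fin (N + 1) → ℂ)) (hι : Function.Injective ι)
    (hT : ∀ v : Fin (M + 1) → ℂ, v ≠ 0 → ∃ᶠ y in 𝓝 v, T.pot (ι y) ≠ ⊥) :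
    (T.restrictLinear ι hι hT).degree = T.degree := rfl

/-- **Restriction can only increase Lelong numbers**: `ν(T, ℙ(ι) x) ≤ ν(T|_{ℙ(ι)}, x)`.
[cite: Siu1974, §2; folklore] -/
theorem lelongNumber_map_le_lelongNumber_restrictLinear (T : ClosedPositiveOneOneCurrent N)
    (ι : (Fin (M + 1) → ℂ) →ₗ[ℂ] (Fin (N + 1) → ℂ)) (hι : Function.Injective ι)
    (hT : ∀ v : Fin (M + 1) → ℂ, v ≠ 0 → ∃ᶠ y in 𝓝 v, T.pot (ι y) ≠ ⊥)
    (x : ℙ ℂ (Fin (M + 1) → ℂ)) :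
    T.lelongNumber (Projectivization.map ι hι x) ≤ (T.restrictLinear ι hι hT).lelongNumber x := by
  set v := x.rep with hv
  have hv0 : v ≠ 0 := Projectivization.rep_nonzero x
  have hιv : ι v ≠ 0 := fun h0 ↦ hv0 (hι (by rw [h0, map_zero]))
  -- `ℙ(ι) x = [ι v]`
  have hmap : Projectivization.map ι hι x = Projectivization.mk ℂ (ι v) hιv := by
    conv_lhs => rw [← Projectivization.mk_rep x]
    rw [Projectivization.map_mk]
  rw [hmap, T.lelongNumber_mk hιv]
  show Pluripotential.lelongNumber T.pot (ι v) ≤ Pluripotential.lelongNumber (T.pot ∘ ι) v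
  -- hypotheses of the pull-back lemma
  set A : (Fin (M + 1) → ℂ) →L[ℂ] (Fin (N + 1) → ℂ) := LinearMap.toContinuousLinearMap ι with hA
  have hAι : ∀ z, A z = ι z := fun z ↦ rfl
  have htend : Tendsto ι (𝓝[≠] v) (𝓝[≠] (ι v)) := by
    refine tendsto_nhdsWithin_of_tendsto_nhds_of_eventually_within _
      (A.continuous.continuousAt.mono_left nhdsWithin_le_nhds) ?_
    filter_upwards [self_mem_nhdsWithin] with z hz
    exact fun h ↦ hz (hι h)
  have hlip : ∀ᶠ z in 𝓝 v, ‖ι z - ι v‖ ≤ (‖A‖ + 1) * ‖z - v‖ := Eventually.of_forall fun z ↦ by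
    rw [← map_sub, ← hAι]
    exact (A.le_opNorm _).trans (mul_le_mul_of_nonneg_right (le_add_of_nonneg_right zero_le_one)
      (norm_nonneg _))
  -- slopes of `V ∘ ι` at `v` are bounded (psh, `≢ -∞` near `v`)
  haveI : Nontrivial (Fin (M + 1) → ℂ) := inferInstance
  have hr : 0 < ‖v‖ / 2 := half_pos (norm_pos_iff.2 hv0)
  have hball : closedBall v (‖v‖ / 2) ⊆ ({0}ᶜ : Set (Fin (M + 1) → ℂ)) := fun z hz h0 ↦ by
    rw [mem_singleton_iff] at h0
    rw [h0, mem_closedBall, dist_zero_left] at hz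
    linarith [norm_pos_iff.2 hv0]
  have hbdd : BddAbove (lelongSlopes (T.pot ∘ ι) v) :=
    (T.restrictLinear ι hι hT).isPlurisubharmonicOn_pot.bddAbove_lelongSlopes_of_ne_bot hr hball
      fun ρ hρ ↦ by
        obtain ⟨z, hz, hz'⟩ := ((hT v hv0).and_eventually (closedBall_mem_nhds v hρ)).exists
        exact ⟨z, hz', hz⟩
  -- `V` is bounded above near `ι v`
  have hr' : 0 < ‖ι v‖ / 2 := half_pos (norm_pos_iff.2 hιv)
  have hball' : closedBall (ι v) (‖ι v‖ / 2) ⊆ ({0}ᶜ : Set (Fin (N + 1) → ℂ)) := fun z hz h0 ↦ by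
    rw [mem_singleton_iff] at h0
    rw [h0, mem_closedBall, dist_zero_left] at hz
    linarith [norm_pos_iff.2 hιv]
  obtain ⟨C, hC⟩ := T.isPlurisubharmonicOn_pot.eventually_le_coe hr' hball'
  exact lelongNumber_comp_ge htend (by positivity) hlip hbdd hC

/-- **Upper level sets are controlled by those of the slices**:
`E_c(T) ∩ ℙ(ι)(ℙᴹ) ⊆ ℙ(ι)(E_c(T|_{ℙ(ι)}))`. [cite: Siu1974, §2; folklore] -/
theorem lelongUpperLevelSet_inter_range_subset (T : ClosedPositiveOneOneCurrent N)
    (ι : (Fin (M + 1) → ℂ) →ₗ[ℂ] (Fin (N + 1) → ℂ)) (hι : Function.Injective ι)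
    (hT : ∀ v : Fin (M + 1) → ℂ, v ≠ 0 → ∃ᶠ y in 𝓝 v, T.pot (ι y) ≠ ⊥) (c : ℝ) :
    T.lelongUpperLevelSet c ∩ range (Projectivization.map ι hι) ⊆
      Projectivization.map ι hι '' (T.restrictLinear ι hι hT).lelongUpperLevelSet c := by
  rintro _ ⟨hx, ⟨y, rfl⟩⟩
  refine ⟨y, ?_, rfl⟩
  rw [mem_lelongUpperLevelSet_iff] at hx ⊢
  exact hx.trans (T.lelongNumber_map_le_lelongNumber_restrictLinear ι hι hT y)

end ClosedPositiveOneOneCurrent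

end Literature.Analysis.Pluripotential

end
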